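import Summits.HodgeConjecture.HodgeConjecture.Theorems.PadicSemiregularLiftFermatAnchorAssemblyEulerCochains
import Mathlib.Algebra.MvPolynomial.PDeriv
import Mathlib.RingTheory.Finiteness.Basic
import Mathlib.Data.Finsupp.Order

/-!
# The `ℤ`-graded Hom complex of a pair of graded matrix factorizations, V: the `xᵢ^{m−1}`-homotopy (line `witt-lift-rigid-mf`)

Crux `FermatAnchorAssembly` (stmt-HodgeConjecture-14874), stub `stub_eulerBaseChange`; continues
`…EulerCochains.lean`.

The two algebraic inputs of the finiteness theorem `Hom(M, N(t)) = 0` for almost all `t`: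

* **the Jacobian ideal acts null-homotopically**: differentiating `φ_M ψ_M = (Σ xᵢᵐ) · 1` gives
  `∂ᵢφ ψ + φ ∂ᵢψ = m xᵢ^{m−1} · 1`, and for a CLOSED even cochain `(a, b)` (`ψ_N a = b ψ_M`,
  `φ_N b = a φ_M`) the odd pair `(s, u) = m⁻¹ (b ∂ᵢψ_M, a ∂ᵢφ_M)` satisfies `hMap (s, u) = xᵢ^{m−1} (a, b)`
  (`X_pow_smul_eq_hMap`; `M` lawful, `m` invertible in the coefficient ring, `N` arbitrary data);
* **a finitely generated `F[x₁, …, x_ν]`-module killed by all `xᵢⁿ` is finite-dimensional over `F`**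
  (`moduleFinite_of_X_pow_smul_eq_zero`: it is spanned by the monomial multiples `xᵉ g` of its
  generators with all `eᵢ < n`).

Registered sub-goal `X_pow_smul_mem_nullSet`-shaped: `jacobian_smul_closed_mem_range`. All `[folklore]`;
no named fact, no `sorry`.
-/

-- `Summit.HodgeConjecture.HodgeConjecture.…` is the tree's mandated summit/problem namespace (single-problem summit).
set_option linter.dupNamespace false

noncomputable section

open Finset MvPolynomial

namespace Summit.HodgeConjecture.HodgeConjecture.Cruxes.FermatAnchorAssembly.WittLiftRigidMf

variable {ν m : ℕ} {A : Type} [CommRing A]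

/-! ### Entrywise partial derivatives of polynomial matrices -/

/-- Leibniz rule for the entrywise partial derivative of a product of polynomial matrices. [folklore] -/
theorem map_pderiv_mul {α β γ : Type} [Fintype β] (i : Fin ν) (P : Matrix α β (MvPolynomial (Fin ν) A))
    (Q : Matrix β γ (MvPolynomial (Fin ν) A)) :
    (P * Q).map (pderiv i) = P.map (pderiv i) * Q + P * Q.map (pderiv i) := by
  ext a c
  simp only [Matrix.map_apply, Matrix.mul_apply, Matrix.add_apply, map_sum, pderiv_mul,
    Finset.sum_add_distrib]

/-- The entrywise derivative of a scalar matrix `f · 1` is `∂ᵢf · 1`. [folklore] -/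
theorem smul_one_map_pderiv {α : Type} [DecidableEq α] (i : Fin ν) (f : MvPolynomial (Fin ν) A) :
    (f • (1 : Matrix α α (MvPolynomial (Fin ν) A))).map (pderiv i) =
      pderiv i f • (1 : Matrix α α (MvPolynomial (Fin ν) A)) := by
  ext a b
  by_cases h : a = b <;> simp [h]

/-- `∂ᵢ (Σⱼ xⱼᵐ) = m xᵢ^{m−1}`. [folklore] -/
theorem pderiv_fermatForm (i : Fin ν) :
    pderiv i (fermatForm A ν m) = (m : MvPolynomial (Fin ν) A) * X i ^ (m - 1) := by
  unfold fermatForm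
  rw [map_sum, Finset.sum_eq_single i]
  · rw [pderiv_pow, pderiv_X_self, mul_one]
  · intro j _ hj
    rw [pderiv_pow, pderiv_X_of_ne hj, mul_zero]
  · intro h
    exact absurd (Finset.mem_univ i) h

/-! ### The `xᵢ^{m−1}`-homotopy -/

namespace GMFData

variable {ι₀ ι₁ κ₀ κ₁ : Type} [Fintype ι₀] [Fintype ι₁] [Fintype κ₀] [Fintype κ₁] [DecidableEq ι₀]
  [DecidableEq ι₁]

/-- **The Jacobian ideal acts null-homotopically.** For a lawful `M`, arbitrary data `N`, `c m = 1` in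
`A`, and a closed even cochain `z = (a, b)` (`dMap M N z = 0`):
`xᵢ^{m−1} · z = hMap M N (c (b ∂ᵢψ_M), c (a ∂ᵢφ_M))`. [cite: BallardFaveroKatzarkov2011, §2 (f acts by zero on Hom in HMF)] -/
theorem X_pow_smul_eq_hMap {L : AddSubgroup (Fin ν → ZMod m)} (M : GMF A ν m L ι₀ ι₁)
    (N : GMFData A ν m κ₀ κ₁) (i : Fin ν) {c : A} (hc : c * m = 1)
    {z : Matrix κ₀ ι₀ (MvPolynomial (Fin ν) A) × Matrix κ₁ ι₁ (MvPolynomial (Fin ν) A)}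
    (hz : dMap M.toGMFData N z = 0) :
    (X i ^ (m - 1) : MvPolynomial (Fin ν) A) • z =
      hMap M.toGMFData N
        ((C c : MvPolynomial (Fin ν) A) • (z.2 * M.ψ.map (pderiv i), z.1 * M.φ.map (pderiv i))) := by
  obtain ⟨a, b⟩ := z
  rw [dMap_apply, Prod.mk_eq_zero, sub_eq_zero, sub_eq_zero] at hz
  obtain ⟨h1, h2⟩ := hz
  change N.ψ * a = b * M.ψ at h1
  change N.φ * b = a * M.φ at h2
  -- the scalar identity `C c * m * xᵢ^{m-1} = xᵢ^{m-1}`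
  have hcm : C c * ((m : MvPolynomial (Fin ν) A) * X i ^ (m - 1)) = X i ^ (m - 1) := by
    rw [← mul_assoc, ← map_natCast (C : A →+* MvPolynomial (Fin ν) A) m, ← map_mul, hc, map_one,
      one_mul]
  -- `∂(φψ) = ∂f · 1`, `∂(ψφ) = ∂f · 1`
  have hφψ : M.φ.map (pderiv i) * M.ψ + M.φ * M.ψ.map (pderiv i) =
      ((m : MvPolynomial (Fin ν) A) * X i ^ (m - 1)) • (1 : Matrix ι₀ ι₀ _) := by
    rw [← map_pderiv_mul, M.φ_mul_ψ, smul_one_map_pderiv, pderiv_fermatForm]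
  have hψφ : M.ψ.map (pderiv i) * M.φ + M.ψ * M.φ.map (pderiv i) =
      ((m : MvPolynomial (Fin ν) A) * X i ^ (m - 1)) • (1 : Matrix ι₁ ι₁ _) := by
    rw [← map_pderiv_mul, M.ψ_mul_φ, smul_one_map_pderiv, pderiv_fermatForm]
  rw [hMap_apply, Prod.smul_mk]
  refine Prod.ext ?_ ?_
  · change X i ^ (m - 1) • a = ((C c : MvPolynomial (Fin ν) A) • (a * M.φ.map (pderiv i))) * M.ψ +
      N.φ * ((C c : MvPolynomial (Fin ν) A) • (b * M.ψ.map (pderiv i)))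
    rw [Matrix.smul_mul, Matrix.mul_smul, ← smul_add, ← Matrix.mul_assoc N.φ, h2, Matrix.mul_assoc,
      Matrix.mul_assoc, ← Matrix.mul_add, hφψ, Matrix.mul_smul, Matrix.mul_one, smul_smul, hcm]
  · change X i ^ (m - 1) • b = ((C c : MvPolynomial (Fin ν) A) • (b * M.ψ.map (pderiv i))) * M.φ +
      N.ψ * ((C c : MvPolynomial (Fin ν) A) • (a * M.φ.map (pderiv i)))
    rw [Matrix.smul_mul, Matrix.mul_smul, ← smul_add, ← Matrix.mul_assoc N.ψ, h1, Matrix.mul_assoc,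
      Matrix.mul_assoc, ← Matrix.mul_add, hψφ, Matrix.mul_smul, Matrix.mul_one, smul_smul, hcm]

/-- Hence `xᵢ^{m−1} · (closed cochains) ⊆ image of hMap` when `m` is invertible in `A`. [folklore] -/
theorem X_pow_smul_mem_range {L : AddSubgroup (Fin ν → ZMod m)} (M : GMF A ν m L ι₀ ι₁)
    (N : GMFData A ν m κ₀ κ₁) (i : Fin ν) (hm : IsUnit (m : A))
    {z : Matrix κ₀ ι₀ (MvPolynomial (Fin ν) A) × Matrix κ₁ ι₁ (MvPolynomial (Fin ν) A)}
    (hz : z ∈ LinearMap.ker (dMap M.toGMFData N)) :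
    (X i ^ (m - 1) : MvPolynomial (Fin ν) A) • z ∈ LinearMap.range (hMap M.toGMFData N) := by
  obtain ⟨u, hu⟩ := hm
  rw [X_pow_smul_eq_hMap M N i (c := (↑u⁻¹ : A)) (by rw [← hu, Units.inv_mul]) (LinearMap.mem_ker.mp hz)]
  exact LinearMap.mem_range_self _ _

end GMFData

/-! ### Finitely generated `F[x]`-modules killed by powers of the variables are finite-dimensional -/

section FiniteDim

variable {F : Type} [Field F] {H : Type} [AddCommGroup H] [Module (MvPolynomial (Fin ν) F) H] [Module F H]
  [IsScalarTower F (MvPolynomial (Fin ν) F) H]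

/-- The exponents with all coordinates `< n` form a finite set. [folklore] -/
theorem finite_setOf_forall_lt (n : ℕ) : {e : Fin ν →₀ ℕ | ∀ i, e i < n}.Finite := by
  have : Finite {e : Fin ν →₀ ℕ | ∀ i, e i < n} :=
    Finite.of_injective (fun e : {e : Fin ν →₀ ℕ | ∀ i, e i < n} ↦ fun i : Fin ν ↦ (⟨e.1 i, e.2 i⟩ : Fin n))
      (by
        intro e₁ e₂ h
        apply Subtype.ext
        ext i
        have := congr_fun h i
        simpa using this)
  exact Set.toFinite _

omit [Module F H] [IsScalarTower F (MvPolynomial (Fin ν) F) H] in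
/-- A monomial with some exponent `≥ n` kills a module on which all `xᵢⁿ` act by zero. [folklore] -/
theorem monomial_smul_eq_zero_of_le {n : ℕ} (hX : ∀ (i : Fin ν) (x : H), (X i ^ n : MvPolynomial (Fin ν) F) • x = 0)
    {e : Fin ν →₀ ℕ} {i : Fin ν} (hi : n ≤ e i) (x : H) :
    (monomial e (1 : F) : MvPolynomial (Fin ν) F) • x = 0 := by
  have he : e = (e - Finsupp.single i n) + Finsupp.single i n :=
    (tsub_add_cancel_of_le (Finsupp.single_le_iff.mpr hi)).symm
  rw [he, ← mul_one (1 : F), ← monomial_mul, ← X_pow_eq_monomial, mul_smul, hX, smul_zero]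

/-- **A finitely generated `F[x₁, …, x_ν]`-module on which every `xᵢⁿ` acts by zero is
finite-dimensional over `F`.** [folklore] -/
theorem moduleFinite_of_X_pow_smul_eq_zero [Module.Finite (MvPolynomial (Fin ν) F) H] (n : ℕ)
    (hX : ∀ (i : Fin ν) (x : H), (X i ^ n : MvPolynomial (Fin ν) F) • x = 0) : Module.Finite F H := by
  classical
  obtain ⟨S, hS⟩ := (inferInstance : Module.Finite (MvPolynomial (Fin ν) F) H).fg_top
  let E : Set (Fin ν →₀ ℕ) := {e | ∀ i, e i < n}
  let T : Set H := (fun p : H × (Fin ν →₀ ℕ) ↦ (monomial p.2 (1 : F) : MvPolynomial (Fin ν) F) • p.1) ''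
    ((↑S : Set H) ×ˢ E)
  have hT : T.Finite := (S.finite_toSet.prod (finite_setOf_forall_lt n)).image _
  -- (a) monomial multiples of generators lie in `span F T`
  have stepA : ∀ s ∈ S, ∀ e : Fin ν →₀ ℕ,
      (monomial e (1 : F) : MvPolynomial (Fin ν) F) • s ∈ Submodule.span F T := by
    intro s hs e
    by_cases h : ∀ i, e i < n
    · exact Submodule.subset_span ⟨(s, e), ⟨hs, h⟩, rfl⟩
    · push Not at h
      obtain ⟨i, hi⟩ := h
      rw [monomial_smul_eq_zero_of_le hX hi]
      exact Submodule.zero_mem _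
  -- (b) all `F[x]`-multiples of generators lie in `span F T`
  have stepB : ∀ s ∈ S, ∀ r : MvPolynomial (Fin ν) F, r • s ∈ Submodule.span F T := by
    intro s hs r
    rw [r.as_sum, Finset.sum_smul]
    refine Submodule.sum_mem _ fun v _ ↦ ?_
    have : (monomial v (coeff v r) : MvPolynomial (Fin ν) F) = coeff v r • monomial v (1 : F) := by
      rw [smul_monomial, smul_eq_mul, mul_one]
    rw [this, smul_assoc]
    exact Submodule.smul_mem _ _ (stepA s hs v)
  -- (c) `span F T` is stable under `F[x]`
  have stepC : ∀ (r : MvPolynomial (Fin ν) F), ∀ y ∈ Submodule.span F T, r • y ∈ Submodule.span F T := by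
    intro r y hy
    induction hy using Submodule.span_induction with
    | mem y hy =>
      obtain ⟨⟨s, e⟩, ⟨hs, _⟩, rfl⟩ := hy
      change r • ((monomial e (1 : F) : MvPolynomial (Fin ν) F) • s) ∈ _
      rw [← mul_smul]
      exact stepB s hs _
    | zero => rw [smul_zero]; exact Submodule.zero_mem _
    | add y₁ y₂ _ _ h₁ h₂ => rw [smul_add]; exact Submodule.add_mem _ h₁ h₂
    | smul a y _ hy => rw [smul_comm]; exact Submodule.smul_mem _ a hy
  -- (d) everything lies in `span F T`
  have stepD : ∀ x : H, x ∈ Submodule.span F T := by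
    intro x
    have hx : x ∈ Submodule.span (MvPolynomial (Fin ν) F) (↑S : Set H) := by rw [hS]; trivial
    induction hx using Submodule.span_induction with
    | mem s hs => simpa using stepB s hs 1
    | zero => exact Submodule.zero_mem _
    | add y₁ y₂ _ _ h₁ h₂ => exact Submodule.add_mem _ h₁ h₂
    | smul r y _ hy => exact stepC r y hy
  refine ⟨⟨hT.toFinset, ?_⟩⟩
  rw [Set.Finite.coe_toFinset]
  exact eq_top_iff.mpr fun x _ ↦ stepD x

end FiniteDim

/-- **Registered sub-goal: the Jacobian ideal of `Σ xᵢᵐ` acts null-homotopically.** For a lawful `M`,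
arbitrary data `N` over a commutative ring in which `m` is a unit, and a closed even cochain `z`,
`xᵢ^{m−1} z` is in the image of the homotopy map `hMap`. [folklore] -/
theorem jacobian_smul_closed_mem_range : ∀ (A : Type) [CommRing A] (ν m : ℕ)
    (L : AddSubgroup (Fin ν → ZMod m)) (ι₀ ι₁ κ₀ κ₁ : Type) [Fintype ι₀] [Fintype ι₁] [Fintype κ₀]
    [Fintype κ₁] [DecidableEq ι₀] [DecidableEq ι₁] (M : GMF A ν m L ι₀ ι₁) (N : GMFData A ν m κ₀ κ₁)
    (i : Fin ν), IsUnit (m : A) →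
    ∀ z ∈ LinearMap.ker (GMFData.dMap M.toGMFData N),
      (MvPolynomial.X i ^ (m - 1) : MvPolynomial (Fin ν) A) • z ∈
        LinearMap.range (GMFData.hMap M.toGMFData N) :=
  fun _ _ _ _ _ _ _ _ _ _ _ _ _ _ _ M N i hm _ hz ↦ GMFData.X_pow_smul_mem_range M N i hm hz

end Summit.HodgeConjecture.HodgeConjecture.Cruxes.FermatAnchorAssembly.WittLiftRigidMf

end
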